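import Literature.NumberTheory.QuadraticFields.RamifiedPrimeNotPrincipal
import HarnessLib

/-!
# A product of two ramified primes of `ℚ(√-n)` above proper prime divisors is not principal when a third ramified prime exists

Topic `NumberTheory/QuadraticFields`, namespace `Literature.NumberTheory.QuadraticFields.RedeiReichardt`.
Theorem-only file (no definition, no named fact), the two-prime sibling of `RamifiedPrimeNotPrincipal.lean`
(`not_isPrincipal_of_sq_eq_span`), again a corollary of the tree's Stevenhagen §2 lemma
`eq_zero_or_eq_indicator_of_isPrincipal` (`RedeiReichardtPrincipalAmbiguous`: a principal product of
ramified primes of `K ∋ √-n` is `(1)` or `(√-n) = ∏_{p ∣ n} 𝔭_p`).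

Let `K` be a quadratic field containing `x` with `x² = -n`, `n` square-free, let `q₁ ≠ q₂` be primes
dividing `n` with ramified primes `𝔭₁, 𝔭₂` (`𝔭ᵢ² = (qᵢ)`), and suppose a third prime `r ∣ n`,
`r ∉ {q₁, q₂}`, exists.  **Then `𝔭₁𝔭₂` is not principal** (`not_isPrincipal_mul_of_sq_eq_span`),
equivalently `[𝔭₁]·[𝔭₂] ≠ 1` in `Cl(𝒪_K)` (`classGroupMk0_mul_ne_one_of_sq_eq_span`): the exponent
vector of `𝔭₁𝔭₂` is neither `0` nor the indicator of all primes of `n` (it misses `r`).  Classically: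
the norm form does not represent the proper divisor `q₁q₂ < n`.  Use (cell `bsd-print-cf2`, crux
stmt-BirchSwinnertonDyer-20509): by Artin reciprocity for the Hilbert class field (Cox Cor. 5.25) the
PRODUCT of the Frobenius elements of `𝔭_{q₁}`, `𝔭_{q₂}` in a ring class field of `ℚ(√-d)` is non-trivial
on the Hilbert class field — a "pair witness" for the square silence of Tian–Yuan–Zhang genus points
(`Summits/BirchSwinnertonDyer/BirchSwinnertonDyer/Theorems/PrintCf2RamifiedOffTYZSquareSilenceWitnesses.lean`).

## References

* P. Stevenhagen, *Rédei-matrices and applications*, LMS LNS 215 (1995), §2 (proof of Thm. 1).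
  [Stevenhagen1995RedeiMatrices]
* D. A. Cox, *Primes of the form x² + ny²*, 2nd ed. (2013), §5.C Thm. 5.23, Cor. 5.25 (PDF p. 124).
  [Cox2013]
-/

noncomputable section

open NumberField Ideal Module
open scoped nonZeroDivisors

namespace Literature.NumberTheory.QuadraticFields.RedeiReichardt

variable {K : Type*} [Field K] [NumberField K]

/-- **A product of two distinct ramified primes above proper prime divisors of `n` is not principal, given a
third prime of `n`.**  `K ∋ x`, `x² = -n` (`n` square-free), `q₁ ≠ q₂` primes dividing `n`, `𝔭ᵢ² = (qᵢ)`,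
and a prime `r ∣ n` with `r ≠ q₁, q₂`.  Proof: enumerate the primes of `disc K` with their ramified primes;
`𝔭₁𝔭₂` is the product with exponent vector `δ_{i₁} + δ_{i₂}`; were it principal, Stevenhagen's lemma would
make that vector `0` (false at `i₁`) or the indicator of `{i : pᵢ ∣ n}` (false at the index of `r`).
[cite: Stevenhagen1995RedeiMatrices, §2 (proof of Thm. 1)] [cite: Cox2013, §5.C Cor. 5.25 (PDF p. 124)] -/
theorem not_isPrincipal_mul_of_sq_eq_span (h2 : finrank ℚ K = 2) {n : ℕ} (hn : Squarefree n) {x : 𝓞 K}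
    (hx : x ^ 2 = -(n : 𝓞 K)) {q₁ q₂ : ℕ} (hq₁ : q₁.Prime) (hq₂ : q₂.Prime) (hne : q₁ ≠ q₂)
    (hq₁n : q₁ ∣ n) (hq₂n : q₂ ∣ n) {r : ℕ} (hr : r.Prime) (hrn : r ∣ n) (hr₁ : r ≠ q₁) (hr₂ : r ≠ q₂)
    {P₁ P₂ : Ideal (𝓞 K)} (hP₁ : P₁ ^ 2 = span {(q₁ : 𝓞 K)}) (hP₂ : P₂ ^ 2 = span {(q₂ : 𝓞 K)}) :
    ¬ (P₁ * P₂).IsPrincipal := by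
  classical
  intro hprinc
  -- `n ∉ {0, 1, 3}`
  have hn1 : n ≠ 1 := by rintro rfl; exact hq₁.ne_one (Nat.dvd_one.mp hq₁n)
  have hn3 : n ≠ 3 := by
    rintro rfl
    have e1 := (Nat.prime_dvd_prime_iff_eq hq₁ Nat.prime_three).mp hq₁n
    have e2 := (Nat.prime_dvd_prime_iff_eq hq₂ Nat.prime_three).mp hq₂n
    exact hne (e1.trans e2.symm)
  have hn0 : n ≠ 0 := Squarefree.ne_zero hn
  -- the primes of the discriminant
  set m : ℕ := if n % 4 = 1 then 2 * n else n with hm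
  have hnm : n ∣ m := by rw [hm]; split_ifs; exacts [Dvd.intro_left 2 rfl, dvd_rfl]
  have hm0 : m ≠ 0 := by rw [hm]; split_ifs <;> omega
  have hmsq : Squarefree m := by
    rw [hm]
    split_ifs with h4
    · exact Nat.squarefree_mul_iff.mpr
        ⟨Nat.coprime_two_left.mpr (Nat.odd_iff.mpr (by omega)), Nat.squarefree_two, hn⟩
    · exact hn
  set e := m.primeFactors.equivFin with he
  set t : ℕ := m.primeFactors.card with ht
  let p : Fin t → ℕ := fun i => ((e.symm i : m.primeFactors) : ℕ)
  have hp : ∀ i, (p i).Prime := fun i => Nat.prime_of_mem_primeFactors (e.symm i).2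
  have hinj : Function.Injective p := Subtype.val_injective.comp e.symm.injective
  have hprod : ∏ i, p i = m := by
    calc ∏ i, p i = ∏ s : m.primeFactors, (s : ℕ) := Fintype.prod_equiv e.symm _ _ fun _ => rfl
      _ = ∏ s ∈ m.primeFactors, s := Finset.prod_coe_sort m.primeFactors (fun j : ℕ => j)
      _ = m := Nat.prod_primeFactors_of_squarefree hmsq
  choose P' hP' using fun i => exists_sq_eq_span hx hp hinj hprod i
  -- the indices of `q₁`, `q₂`, `r`
  have hq₁m : q₁ ∈ m.primeFactors := Nat.mem_primeFactors.mpr ⟨hq₁, hq₁n.trans hnm, hm0⟩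
  have hq₂m : q₂ ∈ m.primeFactors := Nat.mem_primeFactors.mpr ⟨hq₂, hq₂n.trans hnm, hm0⟩
  have hrm : r ∈ m.primeFactors := Nat.mem_primeFactors.mpr ⟨hr, hrn.trans hnm, hm0⟩
  set i₁ : Fin t := e ⟨q₁, hq₁m⟩ with hi₁
  set i₂ : Fin t := e ⟨q₂, hq₂m⟩ with hi₂
  set iᵣ : Fin t := e ⟨r, hrm⟩ with hiᵣ
  have hpe : ∀ (q : ℕ) (hq : q ∈ m.primeFactors), p (e ⟨q, hq⟩) = q := fun q hq => by
    show ((e.symm (e ⟨q, hq⟩) : m.primeFactors) : ℕ) = q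
    rw [Equiv.symm_apply_apply]
  have hne_idx : ∀ {a b : ℕ} (ha : a ∈ m.primeFactors) (hb : b ∈ m.primeFactors), a ≠ b → e ⟨a, ha⟩ ≠ e ⟨b, hb⟩ :=
    fun ha hb hab h => hab (congrArg (fun s : m.primeFactors => (s : ℕ)) (e.injective h))
  have h12 : i₁ ≠ i₂ := hne_idx hq₁m hq₂m hne
  have hr1 : iᵣ ≠ i₁ := hne_idx hrm hq₁m hr₁
  have hr2 : iᵣ ≠ i₂ := hne_idx hrm hq₂m hr₂
  -- `Pⱼ = 𝔭_{iⱼ}`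
  have hmemP : ∀ {q : ℕ} {P : Ideal (𝓞 K)}, P ^ 2 = span {(q : 𝓞 K)} → (q : 𝓞 K) ∈ P := fun hP =>
    Ideal.pow_le_self two_ne_zero (hP ▸ mem_span_singleton_self _)
  have hP₁eq : P₁ = P' i₁ :=
    eq_of_sq_eq_span_of_mem h2 (hp i₁) (hP' i₁) (isMaximal_of_sq_eq_span h2 hq₁ hP₁).isPrime
      ((hpe q₁ hq₁m).symm ▸ hmemP hP₁)
  have hP₂eq : P₂ = P' i₂ :=
    eq_of_sq_eq_span_of_mem h2 (hp i₂) (hP' i₂) (isMaximal_of_sq_eq_span h2 hq₂ hP₂).isPrime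
      ((hpe q₂ hq₂m).symm ▸ hmemP hP₂)
  -- the exponent vector `δ_{i₁} + δ_{i₂}`
  let e₀ : Fin t → ZMod 2 := fun i => if i = i₁ ∨ i = i₂ then 1 else 0
  have hpair : ∏ i, P' i ^ (e₀ i).val = P' i₁ * P' i₂ := by
    rw [← Finset.prod_filter_mul_prod_filter_not Finset.univ (fun i => i = i₁ ∨ i = i₂)]
    have hfilt : Finset.univ.filter (fun i : Fin t => i = i₁ ∨ i = i₂) = {i₁, i₂} := by
      ext i; simp [Finset.mem_insert, Finset.mem_singleton]
    have hrest : ∏ i ∈ Finset.univ.filter (fun i : Fin t => ¬ (i = i₁ ∨ i = i₂)), P' i ^ (e₀ i).val = 1 :=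
      Finset.prod_eq_one fun i hi => by
        have hi' := (Finset.mem_filter.mp hi).2
        simp only [e₀, if_neg hi']
        rw [ZMod.val_zero, pow_zero]
    rw [hrest, mul_one, hfilt, Finset.prod_pair h12]
    simp only [e₀, if_pos (Or.inl rfl), if_pos (Or.inr rfl)]
    rw [show (1 : ZMod 2).val = 1 from rfl, pow_one, pow_one]
  have hprinc' : (∏ i, P' i ^ (e₀ i).val).IsPrincipal := by rwa [hpair, ← hP₁eq, ← hP₂eq]
  rcases eq_zero_or_eq_indicator_of_isPrincipal h2 hx hp hinj hprod hP' hn1 hn3 e₀ hprinc' with h0 | h1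
  · have := congr_fun h0 i₁
    simp [e₀] at this
  · have hpr : p iᵣ = r := hpe r hrm
    have := congr_fun h1 iᵣ
    simp only [e₀, if_neg (not_or.mpr ⟨hr1, hr2⟩)] at this
    rw [hpr, if_pos hrn] at this
    exact zero_ne_one this

/-- **Class-group form**: with the same data, `[𝔭₁]·[𝔭₂] ≠ 1` in `Cl(𝒪_K)`.
[cite: Stevenhagen1995RedeiMatrices, §2 (proof of Thm. 1)] [cite: Cox2013, §5.C Cor. 5.25 (PDF p. 124)] -/
theorem classGroupMk0_mul_ne_one_of_sq_eq_span (h2 : finrank ℚ K = 2) {n : ℕ} (hn : Squarefree n) {x : 𝓞 K}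
    (hx : x ^ 2 = -(n : 𝓞 K)) {q₁ q₂ : ℕ} (hq₁ : q₁.Prime) (hq₂ : q₂.Prime) (hne : q₁ ≠ q₂)
    (hq₁n : q₁ ∣ n) (hq₂n : q₂ ∣ n) {r : ℕ} (hr : r.Prime) (hrn : r ∣ n) (hr₁ : r ≠ q₁) (hr₂ : r ≠ q₂)
    {P₁ P₂ : Ideal (𝓞 K)} (hP₁ : P₁ ^ 2 = span {(q₁ : 𝓞 K)}) (hP₂ : P₂ ^ 2 = span {(q₂ : 𝓞 K)})
    (hP₁0 : P₁ ∈ (Ideal (𝓞 K))⁰) (hP₂0 : P₂ ∈ (Ideal (𝓞 K))⁰) :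
    ClassGroup.mk0 ⟨P₁, hP₁0⟩ * ClassGroup.mk0 ⟨P₂, hP₂0⟩ ≠ 1 := by
  rw [← map_mul, Ne, ClassGroup.mk0_eq_one_iff]
  exact not_isPrincipal_mul_of_sq_eq_span h2 hn hx hq₁ hq₂ hne hq₁n hq₂n hr hrn hr₁ hr₂ hP₁ hP₂

end Literature.NumberTheory.QuadraticFields.RedeiReichardt

end
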